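import Mathlib
import Summits.ResolutionOfSingularities.ResolutionOfSingularities.Theses.PAlteration
import Summits.ResolutionOfSingularities.ResolutionOfSingularities.Theorems.PicoverLocalModel.Negative.PowerDichotomy
import Summits.ResolutionOfSingularities.ResolutionOfSingularities.Theorems.PAlterationPicoverLocalModelFiniteDim
import Summits.ResolutionOfSingularities.ResolutionOfSingularities.Theorems.PAlterationPicoverLocalModelPullbackIntegral
import Summits.ResolutionOfSingularities.ResolutionOfSingularities.Theorems.PAlterationPicoverLocalModelModificationTransfer
import Literature.AlgebraicGeometry.Resolution.KummerNormalForm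
import Literature.AlgebraicGeometry.Resolution.LogRegularAtlasGluing
import Literature.AlgebraicGeometry.Resolution.DivisorialMonoid
import Literature.AlgebraicGeometry.Resolution.QuasiProjectiveResolution
import Summits.ResolutionOfSingularities.ResolutionOfSingularities.Theorems.PAlterationPicoverLocalModelLocalCharts
import Literature.AlgebraicGeometry.Resolution.SurfaceResolutionReduction
import Summits.ResolutionOfSingularities.ResolutionOfSingularities.Theorems.PAlterationPicoverLocalModelBadLocusFinite
import Summits.ResolutionOfSingularities.ResolutionOfSingularities.Theorems.PAlterationPicoverLocalModelBoundaryPointNormalForm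
import Summits.ResolutionOfSingularities.ResolutionOfSingularities.Theorems.PAlterationPicoverLocalModelSpecCurveNormalForm

/-!
# Crux `PicoverLocalModel` (stmt-ResolutionOfSingularities-0557) — line `SketchIdeator3`
# (card `giraud-cossart-normal-form`, companion `top-locus-by-function-fields`) — lead skeleton v7

The crux: for every prime `p`, field `k` of characteristic `p`, regular finitely generated
`k`-domain `R` and `a ∈ R`, the reduced local model `Spec (R[T]/(T^p - a))_red` has a (weak)
resolution of singularities.

Line ("normalise the radicand, not the cover"; Giraud 1983, Cossart 1987, Posva 2024 App. A):
* WLOG `a ∉ R^p` (tree: `Negative.picoverLocalModel_iff_nonpower`), so the model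
  `X_a = Spec R[T]/(T^p - a)` is integral and `R` is normal;
* `FiniteDim.stub_finiteDim` (LANDED p106226): a finitely generated `k`-domain has finite Krull
  dimension (the residue is graded by the dimension `n` of the base);
* `cossartNormalForm` (v6: graded; stubs `stub_badLocusFinite`, `stub_boundaryPointNormalForm`,
  `stub_specCurveNormalForm` for `n ≤ 1`, `stub_cossartNormalForm_ge_two` for `n ≥ 2`) — THE
  RESIDUE (Giraud's conjecture 1983 p. 115 / Cossart's `J(W,a,E) = 𝒪_W`): some proper birational REGULAR modification `π : W → Spec R` with an snc
  boundary `E` puts the class of `a` in GIRAUD NORMAL FORM (`InGiraudNormalForm`, the intrinsic,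
  derivation-free rendering in `Literature/…/KummerNormalForm.lean`) at every point of `W`
  (Giraud 1983 Thm 2.4: `n = 2`; Cossart 1987: `n = 3`; OPEN `n ≥ 4` =
  `Literature.Barriers.ResolutionOfSingularities.DimensionFourFrontier`);
* `LocalCharts.stub_localCharts` (LANDED p145190) — THE ENDGAME, ALGEBRAIC HALF (Giraud 1983
  Prop. 1.5 + Kummer twist + wound/transversal exits p107168 / p111756 / p112113 / p110299;
  Kato 1994 Thm. 11.6): every point of the normalisation `Y^ν` of the pulled-back model
  `X_a ×_{Spec R} W` of a radicand in Giraud normal form along an snc boundary of a regular `W`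
  has a local fs chart, log regular at every prime, for the boundary log structure: regular with
  snc boundary over the wound/transversal points, toric `w^p = ∏ x_j^{A_j mod p}` over the Kummer
  points; glued into a `LogRegularAtlas` on `Y^ν` by `endgameAtlas`;
* THE ENDGAME, RESOLUTION HALF = the NAMED FACT `Kato1994_logRegular_hasResolution_general`
  (Kato 1994 (10.4) / Nizioł 2006 Thm 5.8: a scheme with a log-regular atlas has a resolution) —
  a printed theorem unproved in tree, isolated as `stub_logResolution` (the line closes the crux
  CONDITIONALLY on it until a literature-prover discharges it);
* `PullbackIntegral.stub_pullbackIntegral` (LANDED p109439): the pulled-back model is integral;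
* `ModificationTransfer.stub_modificationTransfer` (LANDED p109722): a resolution of `X ×_Y W`
  gives one of `X` whenever `π : W → Y` is proper birational, `X → Y` dominant.
`PicoverLocalModel_of` composes them into the crux BY NAME.

v3 (lead c1, 2026-08-17): the three landed stubs are imported (sorries 5 → 2); the line's own
copies of `KummerNormalFormAt` / `InKummerNormalForm` are replaced by the Literature predicates,
and the residue/endgame interface is the WEAKER intrinsic `InGiraudNormalForm` (better residue,
same endgame: `KummerNormalFormAt.giraudNormalFormAt`); the v2 endgame `stub_logRegularEndgame`
is split into `stub_endgameAtlas` (algebra) + `stub_logResolution` (the named fact, Kato), and is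
now a theorem (`hasResolution_pullback_of_endgameAtlas`).

v4 (lead c1, 2026-08-17, after the cycle-2 worker wave): `stub_endgameAtlas` is in turn a
theorem (`endgameAtlas`: the normalisation `Y^ν → Y` is finite hence proper, birational, and
`Y^ν` carries the atlas glued — `Literature.….logRegularAtlas_of_localLogRegularChart`, landed
p136149 — from local charts) modulo the pointwise `stub_localCharts`: every point of `Y^ν` has an
affine fs chart, log regular at every prime, with stalk monoids the boundary log structure
(`Literature.….divisorialMonoid`, landed p136274) of the preimage of `E`.

v5 (lead c1, 2026-08-17, after the cycle-2 second wave): `stub_localCharts` LANDED (p145190,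
`LocalCharts.stub_localCharts`, on top of p141213 p142517 p142518 p143897 p144079 p144243 p144456
p144565 and the Literature files KummerCone / KummerChart / KummerChartLogRegular /
KummerToricDivisorial / KummerConeFaces / NormalizationLocalRings / PCyclicCoverSections / … of the
same day) and is imported: the ENDGAME's algebraic half is closed. The skeleton's remaining
sorries are exactly `stub_cossartNormalForm` (the residue: Giraud–Cossart normal form, open for
`n ≥ 4`) and `stub_logResolution` (the named fact Kato 1994 (10.4)).

v6 (lead c2, 2026-08-17, cycle 3): THE RESIDUE IS GRADED BY DIMENSION. `stub_cossartNormalForm`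
becomes the theorem `cossartNormalForm` = case split on `n`: for `n ≤ 1` (regular affine curves
and points) it is composed (`cossartNormalForm_le_one`: `W = Spec R`, `π = 𝟙`, boundary = the
finitely many bad closed points) from three registered provable stubs — `stub_badLocusFinite`
(off finitely many closed points `a - g^p` is wound or transversal; conductor of `R[a^{1/p}]` in
its Noether-finite normalisation), `stub_boundaryPointNormalForm` (DVR dichotomy p110496 at a
closed point, its hypothesis `∃ N, a ∉ O^p + 𝔪^N` from finiteness of the normalisation + Krull)
and `stub_specCurveNormalForm` (scheme plumbing: `HasSNC` for finitely many points of a regular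
curve, `InGiraudNormalForm` from the stalk-wise statements); for `n ≥ 2` it is the open stub
`stub_cossartNormalForm_ge_two` (in print `n = 2` over perfect `k`, `n = 3` over `k = k̄`).

v7 (lead c2, 2026-08-17, cycle 3, after the wave): the three `n ≤ 1` stubs LANDED (p150029,
p151218, p151768) and are imported; the skeleton's sorries are again exactly two — the open
residue `stub_cossartNormalForm_ge_two` (now honestly `n ≥ 2` only) and the named fact
`stub_logResolution` (Kato 1994 (10.4)).
-/

noncomputable section

set_option linter.dupNamespace false

open CategoryTheory CategoryTheory.Limits AlgebraicGeometry TopologicalSpace Polynomial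
open Literature.AlgebraicGeometry.Resolution
open Summit.ResolutionOfSingularities.ResolutionOfSingularities.Theorems.PicoverLocalModel

namespace Summit.ResolutionOfSingularities.ResolutionOfSingularities.Cruxes.PicoverLocalModel.GiraudCossartNormalForm


/-! ## Stubs -/

/-- **The endgame atlas** (v3's `stub_endgameAtlas`, now a theorem modulo `stub_localCharts`):
the normalisation `ν : Y^ν → Y` of the pulled-back model is finite (E. Noether) hence proper,
birational, and `Y^ν` (quasi-compact, locally Noetherian) carries the log-regular atlas glued
from the local charts (`logRegularAtlas_of_localLogRegularChart`). [folklore] -/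
theorem endgameAtlas (p : ℕ) [Fact p.Prime] (k : Type) [Field k] [CharP k p]
    (W : Scheme.{0}) (f : W ⟶ Spec (.of k)) [IsSeparated f] [LocallyOfFiniteType f]
    [QuasiCompact f] [IsIntegral W] (hW : Scheme.IsRegular W)
    (R : Type) [CommRing R] (π : W ⟶ Spec (.of R)) (a : R) (E : List W.IdealSheafData)
    (hE : HasSNC E) (hNF : InGiraudNormalForm p W π a E)
    (hint : IsIntegral (pullback
        (Spec.map (CommRingCat.ofHom (algebraMap R (AdjoinRoot ((X : R[X]) ^ p - C a))))) π)) :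
    ∃ (Y' : Scheme.{0}) (ν : Y' ⟶ pullback
        (Spec.map (CommRingCat.ofHom (algebraMap R (AdjoinRoot ((X : R[X]) ^ p - C a))))) π),
      IsProper ν ∧ IsBirational ν ∧ Nonempty (LogRegularAtlas Y') := by
  haveI := hint
  set Y := pullback (Spec.map (CommRingCat.ofHom
    (algebraMap R (AdjoinRoot ((X : R[X]) ^ p - C a))))) π with hY
  haveI := PullbackIntegral.isFinite_model p R a
  haveI : CompactSpace ↥W := QuasiCompact.compactSpace_of_compactSpace f
  let g : Y ⟶ Spec (.of k) := pullback.snd _ _ ≫ f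
  haveI : LocallyOfFiniteType g := inferInstance
  haveI := isFinite_normalizationι Y NoetherFiniteIntegralClosure_holds g
  haveI : CompactSpace ↥Y := QuasiCompact.compactSpace_of_compactSpace (pullback.snd _ _ : Y ⟶ W)
  haveI : CompactSpace ↥(normalization Y) :=
    QuasiCompact.compactSpace_of_compactSpace (normalizationι Y)
  haveI : IsLocallyNoetherian (normalization Y) :=
    LocallyOfFiniteType.isLocallyNoetherian (normalizationι Y ≫ g)
  refine ⟨normalization Y, normalizationι Y, inferInstance, isBirational_normalizationι Y g, ?_⟩
  exact logRegularAtlas_of_localLogRegularChart _ _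
    (LocalCharts.stub_localCharts p k W f hW R π a E hE hNF)

/-! ### The residue, graded by the dimension `n` of the base (v6)

`n ≤ 1` (the base is a regular affine curve or a point) is PROVED: it was cut into three
registered stubs — two commutative-algebra statements about the localizations `R_q`
(`BadLocusFinite.stub_badLocusFinite`, LANDED p150029; `BoundaryPointNormalForm.stub_boundaryPointNormalForm`,
LANDED p151218) and one piece of scheme plumbing on `Spec R`
(`SpecCurveNormalForm.stub_specCurveNormalForm`, LANDED p151768) — whose composition
`cossartNormalForm_le_one` is the `n ≤ 1` case with `W = Spec R`, `π = 𝟙`, boundary = the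
finitely many bad closed points; `n ≥ 2` is the open
residue `stub_cossartNormalForm_ge_two` (in print: `n = 2` Giraud 1983 — perfect ground field —,
`n = 3` Cossart 1987 for `k` algebraically closed; OPEN `n ≥ 4`, and `n = 2, 3` over imperfect `k`). -/




/-- STUB — THE RESIDUE PROPER (research content; Giraud's conjecture 1983 p. 115 / Cossart's
`J(W,a,E) = 𝒪_W`). In print: `n = 2` for F-FINITE bases — Giraud 1983 Thm. 2.4 requires
`Ω_{X/𝔽_p}` of finite rank, i.e. `[k : k^p] < ∞` (all finitely generated and all perfect `k`),
his condition (**) being this boundary-adapted normal form by Prop. 1.5 (ii) (Zariski-local;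
(c-1) = Kummer exit, (c-2) "differentially free" = wound-or-transversal); `n = 3` for `k`
algebraically closed (Cossart 1987, Posva 2024 App. A). OPEN: `n ≥ 4` (Giraud's conjecture =
`Literature.Barriers.ResolutionOfSingularities.DimensionFourFrontier`), `n = 3` over non-closed
`k`, and `n = 2, 3` over `k` with `[k : k^p] = ∞`. **Giraud–Cossart normal form in dimension
`n ≥ 2`**: for `R` a
regular finitely generated `k`-domain of dimension `≤ n` (`char k = p`) and `a ∈ R ∖ R^p` there
are a proper birational `π : W → Spec R` with `W` regular and integral and an snc boundary `E` on
`W` such that `π^* a` is in (intrinsic, boundary-adapted) Giraud normal form along `E` at every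
point of `W` (on paper: blow up regular centres inside `Sing(W_i, a, E_i) = V(J)` until Cossart's
cofactor ideal is trivial, keeping the components of the total transform of `V(a)` in the
boundary). -/
theorem stub_cossartNormalForm_ge_two : ∀ (n : ℕ), 2 ≤ n → ∀ (p : ℕ), p.Prime →
    ∀ (k : Type) [Field k] [CharP k p]
    (R : Type) [CommRing R] [IsDomain R] [Algebra k R], Algebra.FiniteType k R → IsRegularRing R →
    ringKrullDim R ≤ n → ∀ a : R, (∀ b : R, b ^ p ≠ a) →
      ∃ (W : Scheme.{0}) (π : W ⟶ Spec (.of R)) (E : List W.IdealSheafData),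
        IsProper π ∧ IsBirational π ∧ IsIntegral W ∧ Scheme.IsRegular W ∧ HasSNC E ∧
          InGiraudNormalForm p W π a E := by
  sorry

/-- **The residue for `n ≤ 1`** (regular affine curves and points), composed from the three
stubs A (finite bad locus), B (boundary points) and C (plumbing on `Spec R`): take `W = Spec R`,
`π = 𝟙`, boundary = the bad closed points. [folklore] -/
theorem cossartNormalForm_le_one : ∀ (p : ℕ), p.Prime → ∀ (k : Type) [Field k] [CharP k p]
    (R : Type) [CommRing R] [IsDomain R] [Algebra k R], Algebra.FiniteType k R → IsRegularRing R →
    ringKrullDim R ≤ 1 → ∀ a : R, (∀ b : R, b ^ p ≠ a) →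
      ∃ (W : Scheme.{0}) (π : W ⟶ Spec (.of R)) (E : List W.IdealSheafData),
        IsProper π ∧ IsBirational π ∧ IsIntegral W ∧ Scheme.IsRegular W ∧ HasSNC E ∧
          InGiraudNormalForm p W π a E := by
  intro p hp k _ _ R _ _ _ hft hreg hdim a ha
  obtain ⟨hfin, hne⟩ := BadLocusFinite.stub_badLocusFinite p hp k R hft hreg hdim a ha
  refine SpecCurveNormalForm.stub_specCurveNormalForm p R hreg hdim a _ hfin (fun q hq => hne q hq) ?_ ?_
  · intro q hq
    by_contra h
    exact hq h
  · intro q hq ϖ hϖ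
    exact BoundaryPointNormalForm.stub_boundaryPointNormalForm p hp k R hft hreg hdim a ha q
      (hne q hq) ϖ hϖ

/-- **The residue in dimension `n`** = the graded case split: `n ≤ 1` proved from stubs A–C,
`n ≥ 2` the open stub. [folklore] -/
theorem cossartNormalForm : ∀ (n : ℕ) (p : ℕ), p.Prime → ∀ (k : Type) [Field k] [CharP k p]
    (R : Type) [CommRing R] [IsDomain R] [Algebra k R], Algebra.FiniteType k R → IsRegularRing R →
    ringKrullDim R ≤ n → ∀ a : R, (∀ b : R, b ^ p ≠ a) →
      ∃ (W : Scheme.{0}) (π : W ⟶ Spec (.of R)) (E : List W.IdealSheafData),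
        IsProper π ∧ IsBirational π ∧ IsIntegral W ∧ Scheme.IsRegular W ∧ HasSNC E ∧
          InGiraudNormalForm p W π a E := by
  intro n p hp k _ _ R _ _ _ hft hreg hn a ha
  by_cases h : n ≤ 1
  · have hdim : ringKrullDim R ≤ 1 := hn.trans (by exact_mod_cast h)
    exact cossartNormalForm_le_one p hp k R hft hreg hdim a ha
  · exact stub_cossartNormalForm_ge_two n (by omega) p hp k R hft hreg hn a ha

/-- STUB — THE ENDGAME, RESOLUTION HALF = the NAMED FACT **Kato 1994, (10.4) (general, multi-chart
form; Nizioł 2006 Thm. 5.8)**: a scheme carrying a log-regular Zariski fs atlas has a resolution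
of singularities (by a subdivision of its fan / one log blow-up). A printed theorem, unproved in
tree (`Literature.AlgebraicGeometry.Resolution.Kato1994_logRegular_hasResolution_general`);
discharging it is the literature-prover debt this line runs on — until then the line closes the
crux CONDITIONALLY. [cite: Kato1994, (10.4)] -/
theorem stub_logResolution : Kato1994_logRegular_hasResolution_general.{0} := by
  sorry

/-! ## Composition -/

/-- **The endgame** (v2's `stub_logRegularEndgame`, now a theorem modulo `stub_endgameAtlas` and
`stub_logResolution` = Kato's resolution of log-regular schemes): the pulled-back model of a
radicand in Giraud normal form has a resolution — resolve the log-regular model `Y'` (Kato 1994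
(10.4) / Nizioł 2006 Thm. 5.8) and come down the proper birational `ν`
(`Scheme.HasResolution.of_isBirational`). [cite: Kato1994, (10.4)] -/
theorem hasResolution_pullback_of_endgameAtlas (p : ℕ) [Fact p.Prime] (k : Type) [Field k] [CharP k p]
    (W : Scheme.{0}) (f : W ⟶ Spec (.of k)) [IsSeparated f] [LocallyOfFiniteType f]
    [QuasiCompact f] [IsIntegral W] (hW : Scheme.IsRegular W)
    (R : Type) [CommRing R] (π : W ⟶ Spec (.of R)) (a : R) (E : List W.IdealSheafData)
    (hE : HasSNC E) (hNF : InGiraudNormalForm p W π a E)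
    (hint : IsIntegral (pullback
        (Spec.map (CommRingCat.ofHom (algebraMap R (AdjoinRoot ((X : R[X]) ^ p - C a))))) π)) :
    Scheme.HasResolution (pullback
        (Spec.map (CommRingCat.ofHom (algebraMap R (AdjoinRoot ((X : R[X]) ^ p - C a))))) π) := by
  obtain ⟨Y', ν, hν, hνbir, ⟨atlas⟩⟩ := endgameAtlas p k W f hW R π a E hE hNF hint
  haveI := hν
  exact Scheme.HasResolution.of_isBirational ν hνbir (stub_logResolution Y' ⟨atlas⟩)

/-- The model `X_a → Spec R` is dominant: `R → R[T]/(T^p - a)` is injective and integral, so the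
map on spectra is surjective. [folklore] -/
theorem isDominant_modelMap (R : Type) [CommRing R] [IsDomain R] (p : ℕ) [Fact p.Prime] (a : R) :
    IsDominant (Spec.map (CommRingCat.ofHom (algebraMap R (AdjoinRoot ((X : R[X]) ^ p - C a))))) := by
  haveI := PullbackIntegral.surjective_model p R a
  exact ⟨(Spec.map (CommRingCat.ofHom
    (algebraMap R (AdjoinRoot ((X : R[X]) ^ p - C a))))).surjective.denseRange⟩

/-- **The line closes the crux modulo its stubs**: `PicoverLocalModel` BY NAME (one of the stubs,
`stub_logResolution`, is the named fact Kato 1994 (10.4), unproved in tree). [folklore] -/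
theorem PicoverLocalModel_of :
    Summit.ResolutionOfSingularities.ResolutionOfSingularities.Theses.PAlteration.PicoverLocalModel := by
  rw [Negative.picoverLocalModel_iff_nonpower]
  intro p hp k _ _ R _ _ _ hft hreg a ha
  haveI : Fact p.Prime := ⟨hp⟩
  haveI : CharP R p := charP_of_injective_algebraMap (algebraMap k R).injective p
  haveI : IsIntegrallyClosed R := Negative.isIntegrallyClosed_of_isRegularRing R
  -- dimension grading
  obtain ⟨n, hn⟩ := FiniteDim.stub_finiteDim k R hft
  -- THE RESIDUE: Giraud–Cossart normal form on a regular modification `W` of the base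
  obtain ⟨W, π, E, hπ, hbir, hW, hWreg, hE, hNF⟩ :=
    cossartNormalForm n p hp k R hft hreg hn a ha
  -- `W` is separated of finite type over `k`
  let g : Spec (.of R) ⟶ Spec (.of k) := Spec.map (CommRingCat.ofHom (algebraMap k R))
  haveI : Algebra.FiniteType k R := hft
  haveI : LocallyOfFiniteType g := Negative.locallyOfFiniteType_Spec_of_finiteType k R
  let f : W ⟶ Spec (.of k) := π ≫ g
  haveI : IsSeparated f := inferInstance
  haveI : LocallyOfFiniteType f := inferInstance
  haveI : QuasiCompact f := inferInstance
  -- the model `X_a → Spec R`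
  set μ : Spec (.of (AdjoinRoot ((X : R[X]) ^ p - C a))) ⟶ Spec (.of R) :=
    Spec.map (CommRingCat.ofHom (algebraMap R (AdjoinRoot ((X : R[X]) ^ p - C a)))) with hμ
  haveI : IsDomain (AdjoinRoot ((X : R[X]) ^ p - C a)) := Negative.isDomain_adjoinRoot_of_not_pow p R ha
  haveI : IsIntegral (Spec (.of (AdjoinRoot ((X : R[X]) ^ p - C a)))) := inferInstance
  haveI : IsDominant μ := isDominant_modelMap R p a
  -- the pulled-back model is integral
  have hint : IsIntegral (pullback μ π) := PullbackIntegral.stub_pullbackIntegral p R a ha W π hbir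
  -- THE ENDGAME: the pulled-back model has a resolution (atlas + Kato)
  have hres : Scheme.HasResolution (pullback μ π) :=
    hasResolution_pullback_of_endgameAtlas p k W f hWreg R π a E hE hNF hint
  -- transfer down to `X_a`
  exact ModificationTransfer.stub_modificationTransfer _ _ W μ π hbir hint hres

end Summit.ResolutionOfSingularities.ResolutionOfSingularities.Cruxes.PicoverLocalModel.GiraudCossartNormalForm

end
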